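import Summits.CriticalPhenomena.PercolationContinuityZ3.Theorems.PercNearOneGluingNoHeavyPcintThirdMemFuture
import Summits.CriticalPhenomena.PercolationContinuityZ3.Theorems.PercNearOneGluingNoHeavyPcintMeanBondReduction
import HarnessLib

/-!
# PCINT lane, reduction B3m (`chordmean_cw`) on the memory-`τ` DANGEROUS-SET automaton — the automaton and the unit comparison

Cell `prim-pcint` (PAPER-2 track (iii): certified intervals for `p_c(ℤ^d)`), seat `prim-pcint-2` (gen 4); support file
(`--supports stmt-CriticalPhenomena-4575`).  Does NOT build on p205010.  Memo: `run/shared/lean/prim/pcint/REDUCTIONS.md` §B3m.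

B3m = B3t (`…ThirdMem`) with one more class of sites: a det-paying site that is the CORNER SITE of the last two steps
(syntactically: `w' = q₁.1 + e_a` for the age-`1` element `q₁`, orthogonal to the new step) is a CORNER-THIRD site (`cm3Set`)
and pays the coin-averaged unit `m ≥ (t + t')/2` instead of `s`.  Per-step weight
`bmwt = tchordF(bchord) · s^{cdet - ctu - cmu} · t^{ctu} · m^{cmu} · (κ̄ | 1)`, automaton `bmeanMemAut`.  Bridge PROVED here:
a corner-third site's new incidence is a full-information corner-third unit (`one_le_uF3_of_mem_cm3Set`, with `uF3` the
time-resolved corner-third units of `…MeanBondUnits`) — the corner site and the perpendicularity recorded in `c3UnitAt` are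
read off the automaton's test, no lattice geometry is needed.
-/

noncomputable section

namespace Summit.CriticalPhenomena.PercolationContinuityZ3.Theorems.Pcint

open Finset Literature.Probability.Percolation Literature.Probability.LatticeModels ChainBond

variable {d : ℕ}

/-! ### The per-step data of the B3m automaton -/

open Classical in
/-- The CORNER-THIRD sites of the step: det-paying sites of the form `q₁.1 + e_a` for a remembered `q₁` of age `1` orthogonal
to the step `a`. [folklore] -/
def cm3Set (kc : ℕ) (S : MState d) (a : Fin d × Bool) : Finset (Site d) :=
  (cdetSet kc S a).filter fun w => ∃ q ∈ S, q.2 = 1 ∧ q.1 a.1 = 0 ∧ w = q.1 + stepVec a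

/-- Corner-third sites are det-paying sites. [folklore] -/
theorem cm3Set_subset (kc : ℕ) (S : MState d) (a : Fin d × Bool) : cm3Set kc S a ⊆ cdetSet kc S a := by
  classical
  exact filter_subset _ _

/-- The number of corner-third units of the step. [folklore] -/
def cmu (kc : ℕ) (S : MState d) (a : Fin d × Bool) : ℕ := (cm3Set kc S a).card

/-- `cmu ≤ 2d`. [folklore] -/
theorem cmu_le (kc : ℕ) (S : MState d) (a : Fin d × Bool) : cmu kc S a ≤ 2 * d := by
  classical
  exact (card_le_card (cm3Set_subset kc S a)).trans ((card_filter_le _ _).trans (card_nbrSites_le _))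

/-- The B3m step factor `tchordF(bchord) · s^{cdet-ctu-cmu} · t^{ctu} · m^{cmu} · κ̄^{[bcorner]}`. [folklore] -/
def bmwt (q1 s t m κb : ℝ) (τ kc : ℕ) (S : MState d) (a : Fin d × Bool) : ℝ :=
  tchordF q1 s t (bchord S a) *
    (s ^ (cdet τ kc S a - ctu kc S a - cmu kc S a) * t ^ ctu kc S a * m ^ cmu kc S a * (if bcorner S a then κb else 1))

/-- The step factor is nonnegative. [folklore] -/
theorem bmwt_nonneg {q1 s t m κb : ℝ} (hq : 0 ≤ q1) (hs : 0 ≤ s) (ht : 0 ≤ t) (hm : 0 ≤ m) (hκb : 0 ≤ κb) (τ kc : ℕ)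
    (S : MState d) (a : Fin d × Bool) : 0 ≤ bmwt q1 s t m κb τ kc S a := by
  unfold bmwt
  have := tchordF_nonneg hq hs ht (bchord S a)
  split_ifs <;> positivity

/-- **The B3m automaton on dangerous-set states.** [folklore] -/
def bmeanMemAut (τ kc : ℕ) (p q1 s t m κb : ℝ) (hp : 0 ≤ p) (hq : 0 ≤ q1) (hs : 0 ≤ s) (ht : 0 ≤ t) (hm : 0 ≤ m)
    (hκb : 0 ≤ κb) : WAut (MState d) (Fin d × Bool) where
  step := mstep τ
  wt S a := p * bmwt q1 s t m κb τ kc S a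
  wt_nonneg S a := mul_nonneg hp (bmwt_nonneg hq hs ht hm hκb τ kc S a)

/-! ### The full-information corner-third units, time by time -/

namespace ChainBond

variable {n : ℕ}

/-- The full-information corner-third units of the incidence of `w` at time `T`. [folklore] -/
def uF3 (kc : ℕ) (γ : Fin n → Fin d × Bool) (w : Site d) (T : ℕ) : ℕ :=
  ((c3Set kc γ w).filter fun k => incAt γ w k = T).card

/-- `uFt + uF3 ≤ uF`. [folklore] -/
theorem uFt_add_uF3_le (kc : ℕ) (γ : Fin n → Fin d × Bool) (w : Site d) (T : ℕ) :
    uFt kc γ w T + uF3 kc γ w T ≤ uF kc γ w T := by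
  classical
  unfold uFt uF3 uF
  rw [← card_union_of_disjoint (disjoint_filter_filter (disjoint_tSet_c3Set kc γ w))]
  exact (card_le_card (union_subset (filter_subset_filter _ (tSet_subset_paySet kc γ w))
    (filter_subset_filter _ (c3Set_subset_paySet kc γ w)))).trans (Nat.le_add_right _ _)

/-- The corner-third units paid at time `T`, over all off-path sites. [folklore] -/
def c3unitsAt (kc : ℕ) (γ : Fin n → Fin d × Bool) (T : ℕ) : ℕ := ∑ w ∈ offSites γ, uF3 kc γ w T

/-- `Σ_T uF3(w,T) = c3Units w`. [folklore] -/
theorem sum_uF3_eq (kc : ℕ) (γ : Fin n → Fin d × Bool) (w : Site d) :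
    ∑ T ∈ range (n + 1), uF3 kc γ w T = c3Units kc γ w := by
  classical
  unfold c3Units uF3
  exact (card_eq_sum_card_fiberwise (f := incAt γ w) (t := range (n + 1)) fun k hk =>
    mem_range.2 (Nat.lt_succ_of_le (mem_incTimes.1 (incAt_mem (mem_c3Set.1 (mem_coe.1 hk)).1.2.1)).1)).symm

/-- **`c3Total = Σ_T c3unitsAt T`.** [folklore] -/
theorem c3Total_eq_sum (kc : ℕ) (γ : Fin n → Fin d × Bool) : c3Total kc γ = ∑ T ∈ range (n + 1), c3unitsAt kc γ T := by
  classical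
  unfold c3Total c3unitsAt
  rw [sum_comm]
  exact sum_congr rfl fun w _ => (sum_uF3_eq kc γ w).symm

/-- **`s3Total = Σ_T (dunitsAt T - tunitsAt T - c3unitsAt T)`.** [folklore] -/
theorem s3Total_eq_sum (kc : ℕ) (γ : Fin n → Fin d × Bool) :
    s3Total kc γ = ∑ T ∈ range (n + 1), (dunitsAt kc γ T - tunitsAt kc γ T - c3unitsAt kc γ T) := by
  classical
  have hle : ∀ w T, uFt kc γ w T + uF3 kc γ w T ≤ uF kc γ w T := fun w T => uFt_add_uF3_le kc γ w T
  calc s3Total kc γ = ∑ w ∈ offSites γ, (∑ T ∈ range (n + 1), uF kc γ w T -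
        (∑ T ∈ range (n + 1), uFt kc γ w T + ∑ T ∈ range (n + 1), uF3 kc γ w T)) := by
        unfold s3Total; exact sum_congr rfl fun w _ => by rw [s3Units, sum_uF_eq, sum_uFt_eq, sum_uF3_eq]; omega
    _ = ∑ w ∈ offSites γ, ∑ T ∈ range (n + 1), (uF kc γ w T - (uFt kc γ w T + uF3 kc γ w T)) :=
        sum_congr rfl fun w _ => by rw [← sum_add_distrib, ← sum_tsub_distrib _ fun T _ => hle w T]
    _ = ∑ T ∈ range (n + 1), ∑ w ∈ offSites γ, (uF kc γ w T - (uFt kc γ w T + uF3 kc γ w T)) := sum_comm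
    _ = ∑ T ∈ range (n + 1), (dunitsAt kc γ T - tunitsAt kc γ T - c3unitsAt kc γ T) :=
        sum_congr rfl fun T _ => by
          rw [dunitsAt, tunitsAt, c3unitsAt, Nat.sub_sub, ← sum_add_distrib, sum_tsub_distrib _ fun w _ => hle w T]

end ChainBond

/-! ### The unit comparison along a self-avoiding word: corner-third sites carry corner-third units -/

section Along

variable (a₀ : Fin d × Bool) {τ kc n : ℕ} {γ : Fin n → Fin d × Bool}

open Classical in
/-- **Corner-third sites carry corner-third units**: at a corner-third site of the step reading letter `t` (`1 ≤ t`), the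
incidence `t + 1` of the absolute site is a full-information corner-third unit (`2 ≤ kc`). [folklore] -/
theorem one_le_uF3_of_mem_cm3Set (hkc : 2 ≤ kc) {t : ℕ} (ht : t < n) {w' : Site d}
    (hw' : w' ∈ cm3Set kc (danger τ (pre a₀ γ t)) (γ ⟨t, ht⟩)) : 1 ≤ uF3 kc γ (w' + wordPos γ t) (t + 1) := by
  set S := danger τ (pre a₀ γ t) with hS
  set w := w' + wordPos γ t with hw
  rw [cm3Set, mem_filter] at hw'
  obtain ⟨hD, q₁, hq₁S, hage, hperp, hwq⟩ := hw'
  have hD' := hD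
  rw [cdetSet, mem_filter, mem_nbrSites] at hD'
  obtain ⟨hadj', -, -, ⟨qd, hqd, hqd2⟩, ⟨ql, hql, hqlk⟩⟩ := hD'
  -- the age-1 element is the previous vertex
  obtain ⟨h1le, hrem1, hq₁1⟩ := isRem_of_mem_danger_pre a₀ ht.le hq₁S
  rw [hage] at h1le hq₁1
  have ht1 : 1 ≤ t := h1le
  have htm : t - 1 < n := by omega
  have hprev : wordPos γ t = wordPos γ (t - 1) + stepVec (γ ⟨t - 1, htm⟩) := by
    conv_lhs => rw [show t = t - 1 + 1 by omega]
    exact wordPos_succ γ htm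
  have hq₁' : q₁.1 = -stepVec (γ ⟨t - 1, htm⟩) := by rw [hq₁1, hprev]; abel
  -- the absolute site is the corner site of steps `t-1, t`, and the steps are perpendicular
  have hCdef : cornerSite γ (t - 1) = wordPos γ (t - 1) + stepVec (γ ⟨t, ht⟩) := by
    rw [cornerSite, dif_pos (show t - 1 + 1 < n by omega)]
    congr 3; exact Fin.ext (by simp only; omega)
  have hwC : w = cornerSite γ (t - 1) := by rw [hw, hwq, hq₁1, hCdef]; abel
  have haxes : (γ ⟨t - 1, htm⟩).1 ≠ (γ ⟨t, ht⟩).1 := by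
    intro hax
    have h0 : q₁.1 (γ ⟨t, ht⟩).1 = 0 := hperp
    rw [hq₁', Pi.neg_apply, ← hax, stepVec_apply_fst] at h0
    revert h0; split_ifs <;> norm_num
  -- adjacency of the new vertex and of `v_{t-1}` to `w`
  have hadj : (zdGraph d).Adj (wordPos γ (t + 1)) w := by
    rw [hw, ← adj_sub_wordPos_iff γ t, ← stepVec_eq_sub ht, add_sub_cancel_right]; exact hadj'
  have hadj1 : (zdGraph d).Adj (wordPos γ (t - 1)) w := by
    rw [hwC, hCdef, zdGraph_adj_iff_stepVec]; exact ⟨_, rfl⟩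
  have hT : t + 1 ∈ incTimes γ w := mem_incTimes.2 ⟨by omega, hadj⟩
  have hTm1 : t - 1 ∈ incTimes γ w := mem_incTimes.2 ⟨by omega, hadj1⟩
  have ht_not : t ∉ incTimes γ w := fun h => zdGraph_no_triangle (zdGraph_adj_wordPos_succ γ ht) hadj (mem_incTimes.1 h).2
  obtain ⟨k, hk, hkT⟩ := exists_incAt_eq hT
  have hidx : ∀ {i}, i ∈ incTimes γ w → i < t + 1 → ∃ j, j < k ∧ incAt γ w j = i := by
    intro i hi hit
    obtain ⟨j, hj, hji⟩ := exists_incAt_eq hi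
    refine ⟨j, ?_, hji⟩
    by_contra hjk
    rcases Nat.lt_or_ge k j with h | h
    · have := incAt_strictMono h hj; omega
    · have : j = k := by omega
      subst this; omega
  -- the previous incidence is `t - 1`
  obtain ⟨j1, hj1, hj1e⟩ := hidx hTm1 (by omega)
  have hk1 : 1 ≤ k := by omega
  have hprevI : incAt γ w (k - 1) = t - 1 := by
    have h1 : incAt γ w j1 ≤ incAt γ w (k - 1) := by
      rcases Nat.lt_or_ge j1 (k - 1) with h | h
      · exact (incAt_strictMono h (by omega)).le
      · have : j1 = k - 1 := by omega
        rw [this]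
    have h2 : incAt γ w (k - 1) < t + 1 := by rw [← hkT]; exact incAt_strictMono (by omega) hk
    have h3 : incAt γ w (k - 1) ≠ t := fun h => ht_not (h ▸ incAt_mem (by omega))
    omega
  -- an older incidence (age ≥ 2) gives `k ≥ 2`
  obtain ⟨hqd_inc, hqd1, hqd_le, -⟩ := inc_of_mem_bcinc a₀ ht hqd
  have hk2 : 2 ≤ k := by
    obtain ⟨j, hj, hji⟩ := hidx hqd_inc (by omega)
    have hne : j ≠ j1 := by
      intro hjj; subst hjj; omega
    rcases Nat.lt_or_ge j j1 with h | h
    · omega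
    · have hlt : j1 < j := by omega
      omega
  -- paid: linked (gap 2 ≤ kc) and not the corner first pair (`k ≥ 2`)
  have hpays : paysAt kc γ w k := ⟨hk1, hk, ⟨hk1, by rw [hkT, hprevI]; omega⟩, fun h => by omega⟩
  have hc3 : c3UnitAt kc γ w k := by
    refine ⟨hpays, hk2, by rw [hkT, hprevI]; omega, by rw [hprevI, ← hwC], ?_⟩
    rw [hprevI]
    exact ⟨by omega, by
      have e1 : (⟨t - 1 + 1, (by omega : t - 1 + 1 < n)⟩ : Fin n) = ⟨t, ht⟩ := Fin.ext (by simp only; omega)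
      rw [e1]; exact haxes⟩
  unfold ChainBond.uF3
  exact card_pos.2 ⟨k, mem_filter.2 ⟨mem_c3Set.2 hc3, hkT⟩⟩

/-- A corner-third site is not a t-site (it has a remembered incidence of age `1`). [folklore] -/
theorem cm3Set_disjoint_ctSet (kc : ℕ) (S : MState d) (a : Fin d × Bool) : Disjoint (cm3Set kc S a) (ctSet kc S a) := by
  classical
  rw [disjoint_left]
  intro w' hm hT
  rw [cm3Set, mem_filter] at hm
  rw [ctSet, mem_filter] at hT
  obtain ⟨-, q₁, hq₁S, hage, -, hwq⟩ := hm
  obtain ⟨-, -, hall⟩ := hT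
  have hq₁ : q₁ ∈ bcinc S w' := by
    refine mem_bcinc.2 ⟨hq₁S, ?_⟩
    rw [hwq, zdGraph_adj_iff_stepVec]; exact ⟨_, rfl⟩
  have := hall q₁ hq₁
  omega

/-- `ctu + cmu ≤ cdet`. [folklore] -/
theorem ctu_add_cmu_le (τ kc : ℕ) (S : MState d) (a : Fin d × Bool) : ctu kc S a + cmu kc S a ≤ cdet τ kc S a := by
  classical
  rw [ctu, cmu, ← card_union_of_disjoint (cm3Set_disjoint_ctSet kc S a).symm]
  exact (card_le_card (union_subset (ctSet_subset kc _ _) (cm3Set_subset kc _ _))).trans (Nat.le_add_right _ _)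

end Along

end Summit.CriticalPhenomena.PercolationContinuityZ3.Theorems.Pcint
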